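import Summits.HubbardSuperconductivity.HubbardSuperconductivity.Theorems.AnisotropyChordTransferFibre3KT2bStrip
import Summits.HubbardSuperconductivity.HubbardSuperconductivity.Theorems.AnisotropyChordTransferFibre3StripWindow
import Summits.HubbardSuperconductivity.HubbardSuperconductivity.Theorems.AnisotropyChordTransferFibre3RowCTShellWinSites

/-!
# Route `AnisotropyChord` / H0 rotor rung, row C (KT-2b) on the t-BLOCKS `64 ≤ L < 128`: the SHARP WINDOW-SHELL MAJORANT (block twin of `…StripWindow` §1 + `…KT2bStrip`'s `ZwS`)

T-FORK (p1 g32, route-lead ruling R4-b; p2's inventory memo HOME/hubbard-h0-rotor-p2/TBLOCK-INVENTORY-g8.md §3–§4): the declarations of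
`…StripWindow` that carry the hypothesis `128 ≤ L` (or a constant that changes below `L = 128`, or the `L2.NamedCell` cell box) restated in the
namespace `RowC.T` with the SAME names for the t-blocks (route-lead ruling R1): analytic layer with `64 ≤ L` and the `L ≥ 64` numerics of p2 g8
(`ManifoldA.nu_ceiling64` (ν < .0359), `manifold_band64`, `second_shell_window64` (±.0012/±.003), `RowC.fmax_uniform64`/`gmin_uniform64`
(same constant .07 + .1ν), `third_shell_window64` (±.0031/±.01), `window_k10_64` ([.24993, .25]), `lam_increment_bound64` (δ = .0022)); cell layer on
block cells `c : L2.TCell` (`cellFinalBoxCB (c.box a₁ a₂)`, `pmem_xTrueT`, `RowC.finalVec_mem_of_cellFinalBoxT`).  The window constants are RE-DERIVED for the wider `L ≥ 64` windows: `N41E.T.BxxN = c_s²(.0062a + .0021c_s)`, `N41E.T.BxyN = c_s²(.0127a + .0038c_s)` (vs `.00384/.00176`, `.0118/.0035` at `L ≥ 128`), `N41E.T.ZwS(N)`, slot lemmas `N41E.T.pxx_sharp_le`/`pxy_sharp_le`, and ★★ `RowC.T.shellWin_sharp(N)`.  Declarations that do not change are NOT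
duplicated (they resolve to `RowC`); proofs are verbatim up to the substitutions.
Prover seat `hubbard-h0-rotor-p1` g32 (route lead); helper for piece A = stmt-HubbardSuperconductivity-23918 of rung 19089 (`--supports`, helper
class).  Nothing here proves superconductivity in the Hubbard model; lemmas for ONE row of ONE conditional reduction on the t-blocks; the rotor TARGET
as originally worded stays FALSE (g15 verdict).  Mathlib + the tree only; no sorry.
-/

set_option linter.dupNamespace false
set_option autoImplicit false

noncomputable section

noncomputable section

open Finset
open scoped BigOperators

namespace Summit.HubbardSuperconductivity.HubbardSuperconductivity.Theorems.AnisotropyChord.Transfer.Fibre3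

namespace N41E

namespace T

/-! ## The sharp window constants for `L ≥ 64` (window numbers `u₁₀ ∈ c_s[.24993,.25]`, `u₁₁ ∈ c_s[.3171,.3196]`,
`u₂₀ ∈ c_s[.3603,.3664]`, `u₂₁ ∈ c_s[.3835,.3898]`, `u₃₀ ∈ c_s[.4202,.4403]` of `RowC.T.site_numbers`) -/

/-- the sharp window constant for `b ∈ {−x̂, 2x̂}` on the blocks: `Bxx = c_s²·(0.0062·a + 0.0021·c_s)` (vs `.00384a + .00176c_s` at `L ≥ 128`). -/
def BxxN (cs a : ℝ) : ℝ := cs ^ 2 * (0.0062 * a + 0.0021 * cs)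

/-- the sharp window constant for `b ∈ {±ŷ, x̂ ± ŷ}` on the blocks: `Bxy = c_s²·(0.0127·a + 0.0038·c_s)` (vs `.0118a + .0035c_s`). -/
def BxyN (cs a : ℝ) : ℝ := cs ^ 2 * (0.0127 * a + 0.0038 * cs)

/-- the sharp window-shell majorant of the blocks `ZwS = 2·Bxx² + 4·Bxy²` in `(c_s, a)`. -/
def ZwS (cs a : ℝ) : ℝ := 2 * BxxN cs a ^ 2 + 4 * BxyN cs a ^ 2

/-- `ZwS` in the cell variables `(t, ν, a)` through `c_s = csN t ν a`. -/
def ZwSN (t ν a : ℝ) : ℝ := ZwS (RowC.csN t ν a) a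

/-- ★ SHARP SLOT LEMMA `xx` on the `L ≥ 64` window box: `|Pxx| ≤ Bxx`.  RECIPE as in `N41E.pxxSharpLe_holds` with
`ξ ∈ c_s[.1103,.11647]`, `ζ ∈ c_s[.0671,.06967]`, `d₃₀ ∈ c_s[.0538,.0800]`, `d₂₁ ∈ c_s[.0171,.0295]`; here the lower estimate of `−Pxx`
is no longer nonnegative (`≥ −.00084·a·c_s²`), so both signs are bounded (`abs_le`). [folklore] -/
theorem pxx_sharp_le (a cs u10 u11 u20 u21 u30 : ℝ) (ha : 0 ≤ a) (hcs : 0 ≤ cs)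
    (h10l : cs * 0.24993 ≤ u10) (h10u : u10 ≤ cs * 0.25) (h11l : cs * 0.3171 ≤ u11) (h11u : u11 ≤ cs * 0.3196)
    (h20l : cs * 0.3603 ≤ u20) (h20u : u20 ≤ cs * 0.3664) (h21l : cs * 0.3835 ≤ u21) (h21u : u21 ≤ cs * 0.3898)
    (h30l : cs * 0.4202 ≤ u30) (h30u : u30 ≤ cs * 0.4403) :
    |Pxx a u10 u11 u20 u21 u30| ≤ BxxN cs a := by
  have hf0 : 0 ≤ a + u10 := by linarith
  have hξl : cs * 0.1103 ≤ u20 - u10 := by linarith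
  have hξu : u20 - u10 ≤ cs * 0.11647 := by linarith
  have hξ0 : 0 ≤ u20 - u10 := by linarith
  have hζl : cs * 0.0671 ≤ u11 - u10 := by linarith
  have hζu : u11 - u10 ≤ cs * 0.06967 := by linarith
  have hζ0 : 0 ≤ u11 - u10 := by linarith
  have hdl : cs * 0.0538 ≤ u30 - u20 := by linarith
  have hdu : u30 - u20 ≤ cs * 0.0800 := by linarith
  have hd0 : 0 ≤ u30 - u20 := by linarith
  have hel : cs * 0.0171 ≤ u21 - u20 := by linarith
  have heu : u21 - u20 ≤ cs * 0.0295 := by linarith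
  have he0 : 0 ≤ u21 - u20 := by linarith
  have hF0 : 0 ≤ a + u20 := by linarith
  have T1u : (a + u10) * ((u20 - u10) * (u30 - u20)) ≤ (a + u10) * (cs * 0.11647 * (cs * 0.0800)) :=
    mul_le_mul_of_nonneg_left (mul2_le hξ0 hd0 hξu hdu) hf0
  have T1l : (a + u10) * (cs * 0.1103 * (cs * 0.0538)) ≤ (a + u10) * ((u20 - u10) * (u30 - u20)) :=
    mul_le_mul_of_nonneg_left (mul2_le (by positivity) (by positivity) hξl hdl) hf0
  have T2u : (a + u10) * ((u11 - u10) * (u21 - u20)) ≤ (a + u10) * (cs * 0.06967 * (cs * 0.0295)) :=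
    mul_le_mul_of_nonneg_left (mul2_le hζ0 he0 hζu heu) hf0
  have T2l : (a + u10) * (cs * 0.0671 * (cs * 0.0171)) ≤ (a + u10) * ((u11 - u10) * (u21 - u20)) :=
    mul_le_mul_of_nonneg_left (mul2_le (by positivity) (by positivity) hζl hel) hf0
  have T3u : (a + u20) * ((u11 - u10) * (u11 - u10)) ≤ (a + cs * 0.3664) * (cs * 0.06967 * (cs * 0.06967)) :=
    mul_le_mul (by linarith) (mul2_le hζ0 hζ0 hζu hζu) (mul_nonneg hζ0 hζ0) (by positivity)
  have T3l : (a + cs * 0.3603) * (cs * 0.0671 * (cs * 0.0671)) ≤ (a + u20) * ((u11 - u10) * (u11 - u10)) :=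
    mul_le_mul (by linarith) (mul2_le (by positivity) (by positivity) hζl hζl) (by positivity) hF0
  have T4u : (a + u10) * ((u20 - u10) * (u20 - u10)) ≤ (a + u10) * (cs * 0.11647 * (cs * 0.11647)) :=
    mul_le_mul_of_nonneg_left (mul2_le hξ0 hξ0 hξu hξu) hf0
  have T4l : (a + u10) * (cs * 0.1103 * (cs * 0.1103)) ≤ (a + u10) * ((u20 - u10) * (u20 - u10)) :=
    mul_le_mul_of_nonneg_left (mul2_le (by positivity) (by positivity) hξl hξl) hf0
  have e : -(Pxx a u10 u11 u20 u21 u30)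
      = (a + u10) * ((u20 - u10) * (u30 - u20)) + 2 * ((a + u10) * ((u11 - u10) * (u21 - u20)))
        + (a + u20) * ((u11 - u10) * (u11 - u10)) - (a + u10) * ((u20 - u10) * (u20 - u10)) := by
    unfold Pxx; ring
  have hcs2 : 0 ≤ cs ^ 2 := sq_nonneg cs
  have hu10 : 0 ≤ u10 := by linarith
  have k1 : 0 ≤ u10 * cs ^ 2 := mul_nonneg hu10 hcs2
  have k2 : 0 ≤ a * cs ^ 2 := mul_nonneg ha hcs2
  have k3 : 0 ≤ cs ^ 3 := pow_nonneg hcs 3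
  have k4 : 0 ≤ (cs * 0.25 - u10) * cs ^ 2 := mul_nonneg (by linarith) hcs2
  have up : -(Pxx a u10 u11 u20 u21 u30) ≤ BxxN cs a := by
    rw [e]; unfold BxxN; linarith [T1u, T2u, T3u, T4l, k1, k2, k3, k4]
  have lo : Pxx a u10 u11 u20 u21 u30 ≤ BxxN cs a := by
    have : -(BxxN cs a) ≤ -(Pxx a u10 u11 u20 u21 u30) := by
      rw [e]; unfold BxxN; linarith [T1l, T2l, T3l, T4u, k1, k2, k3, k4]
    linarith
  exact abs_le.mpr ⟨by linarith, lo⟩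

/-- ★ SHARP SLOT LEMMA `xy` on the `L ≥ 64` window box: `|Pxy| ≤ Bxy` (`d′₂₁ ∈ c_s[.0639,.0727]`; `−Pxy ≥ 0` still holds). [folklore] -/
theorem pxy_sharp_le (a cs u10 u11 u20 u21 : ℝ) (ha : 0 ≤ a) (hcs : 0 ≤ cs)
    (h10l : cs * 0.24993 ≤ u10) (h10u : u10 ≤ cs * 0.25) (h11l : cs * 0.3171 ≤ u11) (h11u : u11 ≤ cs * 0.3196)
    (h20l : cs * 0.3603 ≤ u20) (h20u : u20 ≤ cs * 0.3664) (h21l : cs * 0.3835 ≤ u21) (h21u : u21 ≤ cs * 0.3898) :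
    |Pxy a u10 u11 u20 u21| ≤ BxyN cs a := by
  have hf0 : 0 ≤ a + u10 := by linarith
  have hξl : cs * 0.1103 ≤ u20 - u10 := by linarith
  have hξu : u20 - u10 ≤ cs * 0.11647 := by linarith
  have hξ0 : 0 ≤ u20 - u10 := by linarith
  have hζl : cs * 0.0671 ≤ u11 - u10 := by linarith
  have hζu : u11 - u10 ≤ cs * 0.06967 := by linarith
  have hζ0 : 0 ≤ u11 - u10 := by linarith
  have hsl : cs * 0.1774 ≤ (u20 - u10) + (u11 - u10) := by linarith
  have hsu : (u20 - u10) + (u11 - u10) ≤ cs * 0.18614 := by linarith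
  have hs0 : 0 ≤ (u20 - u10) + (u11 - u10) := by linarith
  have hdl : cs * 0.0639 ≤ u21 - u11 := by linarith
  have hdu : u21 - u11 ≤ cs * 0.0727 := by linarith
  have hd0 : 0 ≤ u21 - u11 := by linarith
  have hF0 : 0 ≤ a + u11 := by linarith
  have S1u : (a + u10) * (((u20 - u10) + (u11 - u10)) * (u21 - u11)) ≤ (a + u10) * (cs * 0.18614 * (cs * 0.0727)) :=
    mul_le_mul_of_nonneg_left (mul2_le hs0 hd0 hsu hdu) hf0
  have S1l : (a + u10) * (cs * 0.1774 * (cs * 0.0639)) ≤ (a + u10) * (((u20 - u10) + (u11 - u10)) * (u21 - u11)) :=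
    mul_le_mul_of_nonneg_left (mul2_le (by positivity) (by positivity) hsl hdl) hf0
  have S2u : (a + u11) * ((u20 - u10) * (u11 - u10)) ≤ (a + cs * 0.3196) * (cs * 0.11647 * (cs * 0.06967)) :=
    mul_le_mul (by linarith) (mul2_le hξ0 hζ0 hξu hζu) (mul_nonneg hξ0 hζ0) (by positivity)
  have S2l : (a + cs * 0.3171) * (cs * 0.1103 * (cs * 0.0671)) ≤ (a + u11) * ((u20 - u10) * (u11 - u10)) :=
    mul_le_mul (by linarith) (mul2_le (by positivity) (by positivity) hξl hζl) (by positivity) hF0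
  have S3u : (a + u10) * ((u11 - u10) * (u11 - u10)) ≤ (a + u10) * (cs * 0.06967 * (cs * 0.06967)) :=
    mul_le_mul_of_nonneg_left (mul2_le hζ0 hζ0 hζu hζu) hf0
  have S3l : (a + u10) * (cs * 0.0671 * (cs * 0.0671)) ≤ (a + u10) * ((u11 - u10) * (u11 - u10)) :=
    mul_le_mul_of_nonneg_left (mul2_le (by positivity) (by positivity) hζl hζl) hf0
  have e : -(Pxy a u10 u11 u20 u21)
      = (a + u10) * (((u20 - u10) + (u11 - u10)) * (u21 - u11)) + (a + u11) * ((u20 - u10) * (u11 - u10))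
        - 2 * ((a + u10) * ((u11 - u10) * (u11 - u10))) := by
    unfold Pxy; ring
  have hcs2 : 0 ≤ cs ^ 2 := sq_nonneg cs
  have hu10 : 0 ≤ u10 := by linarith
  have k1 : 0 ≤ u10 * cs ^ 2 := mul_nonneg hu10 hcs2
  have k2 : 0 ≤ a * cs ^ 2 := mul_nonneg ha hcs2
  have k3 : 0 ≤ cs ^ 3 := pow_nonneg hcs 3
  have k4 : 0 ≤ (cs * 0.25 - u10) * cs ^ 2 := mul_nonneg (by linarith) hcs2
  have up : -(Pxy a u10 u11 u20 u21) ≤ BxyN cs a := by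
    rw [e]; unfold BxyN; linarith [S1u, S2u, S3l, k1, k2, k3, k4]
  have lo : 0 ≤ -(Pxy a u10 u11 u20 u21) := by
    rw [e]; linarith [S1l, S2l, S3u, k1, k2, k3, k4]
  rw [abs_of_nonpos (by linarith)]
  exact up

end T

end N41E

namespace RowC

namespace T

variable (L : ℕ) [NeZero L]


/-- the window configuration `b = 2x̂` in cancelled form: `C0(x̂, b) = Pxx(a, u₁₀, u₁₁, u₂₀, u₂₁, u₃₀)`
(`c0_shell_PQRT` + `site_values` + `ring`). [folklore] -/
theorem c0_win_xx_eq (hL : 64 ≤ L) {Δ lam2 : ℝ} {f : Tor L → ℝ} (hΔ0 : 0 ≤ Δ) (hΔ1 : Δ < 1)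
    (hf : IsGroundTwoMagnon L Δ lam2 f) :
    C0fn L Δ lam2 f (ex L, ex L + ex L) = N41E.Pxx (Δ * f (K1 L)) (cS L Δ lam2 f * aKer L lam2 (B1.toTor L ((1 : ℤ), (0 : ℤ)))) (cS L Δ lam2 f * aKer L lam2 (B1.toTor L ((1 : ℤ), (1 : ℤ)))) (cS L Δ lam2 f * aKer L lam2 (B1.toTor L ((2 : ℤ), (0 : ℤ)))) (cS L Δ lam2 f * aKer L lam2 (B1.toTor L ((2 : ℤ), (1 : ℤ)))) (cS L Δ lam2 f * aKer L lam2 (B1.toTor L ((3 : ℤ), (0 : ℤ)))) := by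
  have hL2 : 2 ≤ L := by omega
  have hL3 : 3 ≤ L := by omega
  obtain ⟨hx, hy, hK⟩ := ex_ey_toTor L
  have hnd := ShellRow.nn_distinct L hL3
  have hex0 : ex L ≠ 0 := hnd.1
  have hey0 : ey L ≠ 0 := by
    rw [← hy]; exact toTor_ne_zero_snd L one_ne_zero (by simp only [abs_one]; exact_mod_cast (show 1 < L by omega))
  have hxmy0 : ex L - ey L ≠ 0 := by
    have e : ex L - ey L = B1.toTor L ((1 : ℤ), (-1 : ℤ)) := by unfold B1.toTor ex ey; ext <;> simp
    rw [e]
    exact toTor_ne_zero_snd L (by norm_num) (by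
      simp only [abs_neg, abs_one]; exact_mod_cast (show 1 < L by omega))
  obtain ⟨v0, v1, v2, v3, v4, v5, v6, v7, v8, v9, v10, v11, v12, v13, v14, v15, v16, v17, v18, v19, v20, v21, v00⟩ :=
    site_values L hL hΔ0 hΔ1 hf
  have hC := ShellRow.c0_shell_PQRT L hL3 hf.1 hf.2.1 (ground_mirror L hL2 hf) (ex L + ex L) (two_ex_ne_zero L hL3) (fun h => hex0 (by simpa using h))
  rw [hC]
  unfold Dgrad xiW zetaW N41E.Pxx
  norm_num only [← hx, ← hy, ← B1.toTor_add, ← B1.toTor_neg, ← toTor_sub, Prod.neg_mk, Prod.mk_add_mk, Prod.mk_sub_mk]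
  norm_num only [v0, v1, v2, v3, v4, v5, v6, v7, v8, v9, v10, v11, v12, v13, v14, v15, v16, v17, v18, v19, v20, v21, v00]
  ring


/-- the window configuration `b = −x̂` in cancelled form: `C0(x̂, b) = Pxx(a, u₁₀, u₁₁, u₂₀, u₂₁, u₃₀)`
(`c0_shell_PQRT` + `site_values` + `ring`). [folklore] -/
theorem c0_win_negx_eq (hL : 64 ≤ L) {Δ lam2 : ℝ} {f : Tor L → ℝ} (hΔ0 : 0 ≤ Δ) (hΔ1 : Δ < 1)
    (hf : IsGroundTwoMagnon L Δ lam2 f) :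
    C0fn L Δ lam2 f (ex L, -ex L) = N41E.Pxx (Δ * f (K1 L)) (cS L Δ lam2 f * aKer L lam2 (B1.toTor L ((1 : ℤ), (0 : ℤ)))) (cS L Δ lam2 f * aKer L lam2 (B1.toTor L ((1 : ℤ), (1 : ℤ)))) (cS L Δ lam2 f * aKer L lam2 (B1.toTor L ((2 : ℤ), (0 : ℤ)))) (cS L Δ lam2 f * aKer L lam2 (B1.toTor L ((2 : ℤ), (1 : ℤ)))) (cS L Δ lam2 f * aKer L lam2 (B1.toTor L ((3 : ℤ), (0 : ℤ)))) := by
  have hL2 : 2 ≤ L := by omega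
  have hL3 : 3 ≤ L := by omega
  obtain ⟨hx, hy, hK⟩ := ex_ey_toTor L
  have hnd := ShellRow.nn_distinct L hL3
  have hex0 : ex L ≠ 0 := hnd.1
  have hey0 : ey L ≠ 0 := by
    rw [← hy]; exact toTor_ne_zero_snd L one_ne_zero (by simp only [abs_one]; exact_mod_cast (show 1 < L by omega))
  have hxmy0 : ex L - ey L ≠ 0 := by
    have e : ex L - ey L = B1.toTor L ((1 : ℤ), (-1 : ℤ)) := by unfold B1.toTor ex ey; ext <;> simp
    rw [e]
    exact toTor_ne_zero_snd L (by norm_num) (by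
      simp only [abs_neg, abs_one]; exact_mod_cast (show 1 < L by omega))
  obtain ⟨v0, v1, v2, v3, v4, v5, v6, v7, v8, v9, v10, v11, v12, v13, v14, v15, v16, v17, v18, v19, v20, v21, v00⟩ :=
    site_values L hL hΔ0 hΔ1 hf
  have hC := ShellRow.c0_shell_PQRT L hL3 hf.1 hf.2.1 (ground_mirror L hL2 hf) (-ex L) (neg_ne_zero.mpr hex0) hnd.2.1
  rw [hC]
  unfold Dgrad xiW zetaW N41E.Pxx
  norm_num only [← hx, ← hy, ← B1.toTor_add, ← B1.toTor_neg, ← toTor_sub, Prod.neg_mk, Prod.mk_add_mk, Prod.mk_sub_mk]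
  norm_num only [v0, v1, v2, v3, v4, v5, v6, v7, v8, v9, v10, v11, v12, v13, v14, v15, v16, v17, v18, v19, v20, v21, v00]
  ring


/-- the window configuration `b = x̂+ŷ` in cancelled form: `C0(x̂, b) = Pxy(a, u₁₀, u₁₁, u₂₀, u₂₁)`
(`c0_shell_PQRT` + `site_values` + `ring`). [folklore] -/
theorem c0_win_xy_eq (hL : 64 ≤ L) {Δ lam2 : ℝ} {f : Tor L → ℝ} (hΔ0 : 0 ≤ Δ) (hΔ1 : Δ < 1)
    (hf : IsGroundTwoMagnon L Δ lam2 f) :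
    C0fn L Δ lam2 f (ex L, ex L + ey L) = N41E.Pxy (Δ * f (K1 L)) (cS L Δ lam2 f * aKer L lam2 (B1.toTor L ((1 : ℤ), (0 : ℤ)))) (cS L Δ lam2 f * aKer L lam2 (B1.toTor L ((1 : ℤ), (1 : ℤ)))) (cS L Δ lam2 f * aKer L lam2 (B1.toTor L ((2 : ℤ), (0 : ℤ)))) (cS L Δ lam2 f * aKer L lam2 (B1.toTor L ((2 : ℤ), (1 : ℤ)))) := by
  have hL2 : 2 ≤ L := by omega
  have hL3 : 3 ≤ L := by omega
  obtain ⟨hx, hy, hK⟩ := ex_ey_toTor L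
  have hnd := ShellRow.nn_distinct L hL3
  have hex0 : ex L ≠ 0 := hnd.1
  have hey0 : ey L ≠ 0 := by
    rw [← hy]; exact toTor_ne_zero_snd L one_ne_zero (by simp only [abs_one]; exact_mod_cast (show 1 < L by omega))
  have hxmy0 : ex L - ey L ≠ 0 := by
    have e : ex L - ey L = B1.toTor L ((1 : ℤ), (-1 : ℤ)) := by unfold B1.toTor ex ey; ext <;> simp
    rw [e]
    exact toTor_ne_zero_snd L (by norm_num) (by
      simp only [abs_neg, abs_one]; exact_mod_cast (show 1 < L by omega))
  obtain ⟨v0, v1, v2, v3, v4, v5, v6, v7, v8, v9, v10, v11, v12, v13, v14, v15, v16, v17, v18, v19, v20, v21, v00⟩ :=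
    site_values L hL hΔ0 hΔ1 hf
  have hC := ShellRow.c0_shell_PQRT L hL3 hf.1 hf.2.1 (ground_mirror L hL2 hf) (ex L + ey L) (ex_add_ey_ne_zero L hL2) (fun h => hey0 (by simpa using h))
  rw [hC]
  unfold Dgrad xiW zetaW N41E.Pxy
  norm_num only [← hx, ← hy, ← B1.toTor_add, ← B1.toTor_neg, ← toTor_sub, Prod.neg_mk, Prod.mk_add_mk, Prod.mk_sub_mk]
  norm_num only [v0, v1, v2, v3, v4, v5, v6, v7, v8, v9, v10, v11, v12, v13, v14, v15, v16, v17, v18, v19, v20, v21, v00]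
  ring


/-- the window configuration `b = x̂−ŷ` in cancelled form: `C0(x̂, b) = Pxy(a, u₁₀, u₁₁, u₂₀, u₂₁)`
(`c0_shell_PQRT` + `site_values` + `ring`). [folklore] -/
theorem c0_win_xmy_eq (hL : 64 ≤ L) {Δ lam2 : ℝ} {f : Tor L → ℝ} (hΔ0 : 0 ≤ Δ) (hΔ1 : Δ < 1)
    (hf : IsGroundTwoMagnon L Δ lam2 f) :
    C0fn L Δ lam2 f (ex L, ex L - ey L) = N41E.Pxy (Δ * f (K1 L)) (cS L Δ lam2 f * aKer L lam2 (B1.toTor L ((1 : ℤ), (0 : ℤ)))) (cS L Δ lam2 f * aKer L lam2 (B1.toTor L ((1 : ℤ), (1 : ℤ)))) (cS L Δ lam2 f * aKer L lam2 (B1.toTor L ((2 : ℤ), (0 : ℤ)))) (cS L Δ lam2 f * aKer L lam2 (B1.toTor L ((2 : ℤ), (1 : ℤ)))) := by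
  have hL2 : 2 ≤ L := by omega
  have hL3 : 3 ≤ L := by omega
  obtain ⟨hx, hy, hK⟩ := ex_ey_toTor L
  have hnd := ShellRow.nn_distinct L hL3
  have hex0 : ex L ≠ 0 := hnd.1
  have hey0 : ey L ≠ 0 := by
    rw [← hy]; exact toTor_ne_zero_snd L one_ne_zero (by simp only [abs_one]; exact_mod_cast (show 1 < L by omega))
  have hxmy0 : ex L - ey L ≠ 0 := by
    have e : ex L - ey L = B1.toTor L ((1 : ℤ), (-1 : ℤ)) := by unfold B1.toTor ex ey; ext <;> simp
    rw [e]
    exact toTor_ne_zero_snd L (by norm_num) (by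
      simp only [abs_neg, abs_one]; exact_mod_cast (show 1 < L by omega))
  obtain ⟨v0, v1, v2, v3, v4, v5, v6, v7, v8, v9, v10, v11, v12, v13, v14, v15, v16, v17, v18, v19, v20, v21, v00⟩ :=
    site_values L hL hΔ0 hΔ1 hf
  have hC := ShellRow.c0_shell_PQRT L hL3 hf.1 hf.2.1 (ground_mirror L hL2 hf) (ex L - ey L) hxmy0 (fun h => hey0 (by simpa using h))
  rw [hC]
  unfold Dgrad xiW zetaW N41E.Pxy
  norm_num only [← hx, ← hy, ← B1.toTor_add, ← B1.toTor_neg, ← toTor_sub, Prod.neg_mk, Prod.mk_add_mk, Prod.mk_sub_mk]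
  norm_num only [v0, v1, v2, v3, v4, v5, v6, v7, v8, v9, v10, v11, v12, v13, v14, v15, v16, v17, v18, v19, v20, v21, v00]
  ring


/-- the window configuration `b = ŷ` in cancelled form: `C0(x̂, b) = Pxy(a, u₁₀, u₁₁, u₂₀, u₂₁)`
(`c0_shell_PQRT` + `site_values` + `ring`). [folklore] -/
theorem c0_win_ey_eq (hL : 64 ≤ L) {Δ lam2 : ℝ} {f : Tor L → ℝ} (hΔ0 : 0 ≤ Δ) (hΔ1 : Δ < 1)
    (hf : IsGroundTwoMagnon L Δ lam2 f) :
    C0fn L Δ lam2 f (ex L, ey L) = N41E.Pxy (Δ * f (K1 L)) (cS L Δ lam2 f * aKer L lam2 (B1.toTor L ((1 : ℤ), (0 : ℤ)))) (cS L Δ lam2 f * aKer L lam2 (B1.toTor L ((1 : ℤ), (1 : ℤ)))) (cS L Δ lam2 f * aKer L lam2 (B1.toTor L ((2 : ℤ), (0 : ℤ)))) (cS L Δ lam2 f * aKer L lam2 (B1.toTor L ((2 : ℤ), (1 : ℤ)))) := by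
  have hL2 : 2 ≤ L := by omega
  have hL3 : 3 ≤ L := by omega
  obtain ⟨hx, hy, hK⟩ := ex_ey_toTor L
  have hnd := ShellRow.nn_distinct L hL3
  have hex0 : ex L ≠ 0 := hnd.1
  have hey0 : ey L ≠ 0 := by
    rw [← hy]; exact toTor_ne_zero_snd L one_ne_zero (by simp only [abs_one]; exact_mod_cast (show 1 < L by omega))
  have hxmy0 : ex L - ey L ≠ 0 := by
    have e : ex L - ey L = B1.toTor L ((1 : ℤ), (-1 : ℤ)) := by unfold B1.toTor ex ey; ext <;> simp
    rw [e]
    exact toTor_ne_zero_snd L (by norm_num) (by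
      simp only [abs_neg, abs_one]; exact_mod_cast (show 1 < L by omega))
  obtain ⟨v0, v1, v2, v3, v4, v5, v6, v7, v8, v9, v10, v11, v12, v13, v14, v15, v16, v17, v18, v19, v20, v21, v00⟩ :=
    site_values L hL hΔ0 hΔ1 hf
  have hC := ShellRow.c0_shell_PQRT L hL3 hf.1 hf.2.1 (ground_mirror L hL2 hf) (ey L) hey0 hnd.2.2.1
  rw [hC]
  unfold Dgrad xiW zetaW N41E.Pxy
  norm_num only [← hx, ← hy, ← B1.toTor_add, ← B1.toTor_neg, ← toTor_sub, Prod.neg_mk, Prod.mk_add_mk, Prod.mk_sub_mk]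
  norm_num only [v0, v1, v2, v3, v4, v5, v6, v7, v8, v9, v10, v11, v12, v13, v14, v15, v16, v17, v18, v19, v20, v21, v00]
  ring


/-- the window configuration `b = −ŷ` in cancelled form: `C0(x̂, b) = Pxy(a, u₁₀, u₁₁, u₂₀, u₂₁)`
(`c0_shell_PQRT` + `site_values` + `ring`). [folklore] -/
theorem c0_win_negy_eq (hL : 64 ≤ L) {Δ lam2 : ℝ} {f : Tor L → ℝ} (hΔ0 : 0 ≤ Δ) (hΔ1 : Δ < 1)
    (hf : IsGroundTwoMagnon L Δ lam2 f) :
    C0fn L Δ lam2 f (ex L, -ey L) = N41E.Pxy (Δ * f (K1 L)) (cS L Δ lam2 f * aKer L lam2 (B1.toTor L ((1 : ℤ), (0 : ℤ)))) (cS L Δ lam2 f * aKer L lam2 (B1.toTor L ((1 : ℤ), (1 : ℤ)))) (cS L Δ lam2 f * aKer L lam2 (B1.toTor L ((2 : ℤ), (0 : ℤ)))) (cS L Δ lam2 f * aKer L lam2 (B1.toTor L ((2 : ℤ), (1 : ℤ)))) := by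
  have hL2 : 2 ≤ L := by omega
  have hL3 : 3 ≤ L := by omega
  obtain ⟨hx, hy, hK⟩ := ex_ey_toTor L
  have hnd := ShellRow.nn_distinct L hL3
  have hex0 : ex L ≠ 0 := hnd.1
  have hey0 : ey L ≠ 0 := by
    rw [← hy]; exact toTor_ne_zero_snd L one_ne_zero (by simp only [abs_one]; exact_mod_cast (show 1 < L by omega))
  have hxmy0 : ex L - ey L ≠ 0 := by
    have e : ex L - ey L = B1.toTor L ((1 : ℤ), (-1 : ℤ)) := by unfold B1.toTor ex ey; ext <;> simp
    rw [e]
    exact toTor_ne_zero_snd L (by norm_num) (by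
      simp only [abs_neg, abs_one]; exact_mod_cast (show 1 < L by omega))
  obtain ⟨v0, v1, v2, v3, v4, v5, v6, v7, v8, v9, v10, v11, v12, v13, v14, v15, v16, v17, v18, v19, v20, v21, v00⟩ :=
    site_values L hL hΔ0 hΔ1 hf
  have hC := ShellRow.c0_shell_PQRT L hL3 hf.1 hf.2.1 (ground_mirror L hL2 hf) (-ey L) (neg_ne_zero.mpr hey0) hnd.2.2.2.1
  rw [hC]
  unfold Dgrad xiW zetaW N41E.Pxy
  norm_num only [← hx, ← hy, ← B1.toTor_add, ← B1.toTor_neg, ← toTor_sub, Prod.neg_mk, Prod.mk_add_mk, Prod.mk_sub_mk]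
  norm_num only [v0, v1, v2, v3, v4, v5, v6, v7, v8, v9, v10, v11, v12, v13, v14, v15, v16, v17, v18, v19, v20, v21, v00]
  ring



/-! ## The sharp window-shell majorant on the blocks -/

/-- ★★ **the sharp window-shell majorant for `L ≥ 64`**: `Σ_{b ∈ shellWin} C0(x̂,b)² ≤ N41E.T.ZwS(c_s, a)` for every ground profile. [folklore] -/
theorem shellWin_sharp (hL : 64 ≤ L) {Δ lam2 : ℝ} {f : Tor L → ℝ} (hΔ0 : 0 ≤ Δ) (hΔ1 : Δ < 1)
    (hf : IsGroundTwoMagnon L Δ lam2 f) :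
    (∑ b ∈ shellWin L, C0fn L Δ lam2 f (ex L, b) ^ 2) ≤ N41E.T.ZwS (cS L Δ lam2 f) (Δ * f (K1 L)) := by
  classical
  obtain ⟨hc0, ha0, hF, hgF, c10l, c10u, c11l, c11u, c20l, c20u, c21l, c21u, c30l, c30u⟩ := site_numbers L hL hΔ0 hΔ1 hf
  have hxx := N41E.T.pxx_sharp_le (Δ * f (K1 L)) (cS L Δ lam2 f) _ _ _ _ _ ha0 hc0 c10l c10u c11l c11u c20l c20u c21l c21u c30l c30u
  have hxy := N41E.T.pxy_sharp_le (Δ * f (K1 L)) (cS L Δ lam2 f) _ _ _ _ ha0 hc0 c10l c10u c11l c11u c20l c20u c21l c21u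
  set Bx : ℝ := N41E.T.BxxN (cS L Δ lam2 f) (Δ * f (K1 L)) with hBx
  set By : ℝ := N41E.T.BxyN (cS L Δ lam2 f) (Δ * f (K1 L)) with hBy
  have e1 : C0fn L Δ lam2 f (ex L, -ex L) ^ 2 ≤ Bx ^ 2 :=
    ShellRow.sq_le_sq_of_abs_le (by rw [c0_win_negx_eq L hL hΔ0 hΔ1 hf]; exact hxx)
  have e2 : C0fn L Δ lam2 f (ex L, ey L) ^ 2 ≤ By ^ 2 :=
    ShellRow.sq_le_sq_of_abs_le (by rw [c0_win_ey_eq L hL hΔ0 hΔ1 hf]; exact hxy)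
  have e3 : C0fn L Δ lam2 f (ex L, -ey L) ^ 2 ≤ By ^ 2 :=
    ShellRow.sq_le_sq_of_abs_le (by rw [c0_win_negy_eq L hL hΔ0 hΔ1 hf]; exact hxy)
  have e4 : C0fn L Δ lam2 f (ex L, ex L + ex L) ^ 2 ≤ Bx ^ 2 :=
    ShellRow.sq_le_sq_of_abs_le (by rw [c0_win_xx_eq L hL hΔ0 hΔ1 hf]; exact hxx)
  have e5 : C0fn L Δ lam2 f (ex L, ex L + ey L) ^ 2 ≤ By ^ 2 :=
    ShellRow.sq_le_sq_of_abs_le (by rw [c0_win_xy_eq L hL hΔ0 hΔ1 hf]; exact hxy)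
  have e6 : C0fn L Δ lam2 f (ex L, ex L - ey L) ^ 2 ≤ By ^ 2 :=
    ShellRow.sq_le_sq_of_abs_le (by rw [c0_win_xmy_eq L hL hΔ0 hΔ1 hf]; exact hxy)
  set g : Tor L → ℝ := fun b => C0fn L Δ lam2 f (ex L, b) ^ 2 with hg
  have hg0 : ∀ b, 0 ≤ g b := fun b => sq_nonneg _
  unfold shellWin
  calc ∑ b ∈ ({-ex L, ey L, -ey L, ex L + ex L, ex L + ey L, ex L - ey L} : Finset (Tor L)), g b
      ≤ g (-ex L) + (g (ey L) + (g (-ey L) + (g (ex L + ex L) + (g (ex L + ey L) + ∑ b ∈ ({ex L - ey L} : Finset (Tor L)), g b)))) := by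
        refine (sum_insert_le_add _ _ g (hg0 _)).trans (add_le_add le_rfl ?_)
        refine (sum_insert_le_add _ _ g (hg0 _)).trans (add_le_add le_rfl ?_)
        refine (sum_insert_le_add _ _ g (hg0 _)).trans (add_le_add le_rfl ?_)
        refine (sum_insert_le_add _ _ g (hg0 _)).trans (add_le_add le_rfl ?_)
        exact (sum_insert_le_add _ _ g (hg0 _)).trans (add_le_add le_rfl le_rfl)
    _ = g (-ex L) + g (ey L) + g (-ey L) + g (ex L + ex L) + g (ex L + ey L) + g (ex L - ey L) := by
        rw [Finset.sum_singleton]; ring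
    _ ≤ Bx ^ 2 + By ^ 2 + By ^ 2 + Bx ^ 2 + By ^ 2 + By ^ 2 := by
        simp only [hg]; linarith [e1, e2, e3, e4, e5, e6]
    _ = N41E.T.ZwS (cS L Δ lam2 f) (Δ * f (K1 L)) := by rw [hBx, hBy]; unfold N41E.T.ZwS; ring

/-- ★★ the same in the CELL VARIABLES (the `hZ` of the sharp row-C cell soundness on the blocks). [folklore] -/
theorem shellWin_sharpN (hL : 64 ≤ L) {Δ lam2 : ℝ} {f : Tor L → ℝ} (hΔ0 : 0 ≤ Δ) (hΔ1 : Δ < 1)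
    (hf : IsGroundTwoMagnon L Δ lam2 f) :
    (∑ b ∈ shellWin L, C0fn L Δ lam2 f (ex L, b) ^ 2)
      ≤ N41E.T.ZwSN ((2 * Real.pi / L) ^ 2) (lam2 / (2 * Real.pi / L) ^ 2) (Δ * f (K1 L)) := by
  have h := shellWin_sharp L hL hΔ0 hΔ1 hf
  obtain ⟨_, hcs, _, _⟩ := dict_N hL hΔ0 hΔ1 hf
  unfold N41E.T.ZwSN
  rw [← hcs]
  exact h

end T

end RowC

end Summit.HubbardSuperconductivity.HubbardSuperconductivity.Theorems.AnisotropyChord.Transfer.Fibre3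

end
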